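/-
Copyright (c) 2026 the pub-hodgecm-mathlib formalisation cell (harness21).  Prover seat hodgecm-mathlib-K2E1-p09 (g4), Track B ∕ K2-LIT,
h413 = `stmt-HodgeConjecture-24833`, line `K2_E1_TraceFormulaBeta`, campaign RES-RANK-ONE, page «EIS-RANK-ONE»: the LEFT ∕ RIGHT BRIDGE queued by the dealer K2E1-plan (g3)
2026-09-04T04:27:29Z ∕ 04:32:53Z (ruling R-EIS-1 (e) «both spellings»).
-/
import Summits.HodgeConjecture.HodgeConjecture.Theorems.K2E1BorelEisensteinUDefs         -- ★ (K2E1-p08 g4): `eisensteinSeriesU` (LEFT convention, index `B(F)\G(F)` of ★ p857160)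
import Summits.HodgeConjecture.HodgeConjecture.Theorems.K2E1EisensteinIntertwiningU      -- ★ p857354 (this seat): `intertwiningU`, «`E_B = φ + M(w₀)φ`» on `U(J₂)`, `U(J₃)` (RIGHT convention)
import Literature.NumberTheory.Automorphic.UnitaryGroupBorelTruncation                  -- ★ `borelConstantTerm` (LEFT convention, normalised by `ν(𝓕)⁻¹`)
import HarnessLib

/-!
# h413 ∕ Track B «K2-LIT», page EIS-RANK-ONE — `K2E1EisensteinSeriesLeftRight`: the LEFT-convention Eisenstein series ★ `eisensteinSeriesU` (K2E1-p08) IS the RIGHT-convention sum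
# `Σ_{Γ⧸B_Γ} φ(x q̃)` of ★ p857309 at `φ = f ∘ inv`, `x = g⁻¹`; hence «`E_B(f)(g) = f(g) + ν(𝓕)⁻¹ ∫_{N(𝔸)} f(w₀ v g) dv`» for ★ `borelConstantTerm` on `U(J₂)`, `U(J₃)`

Cell `pub/hodgecm-mathlib`, crux H413 = `stmt-HodgeConjecture-24833`, route `HCCMUnconditional`; dealer K2E1-plan (g3).  THEOREMS ONLY (no `def`, no `instance`, no `notation`, no
named-fact hypothesis, no `sorry`); lane `--kind proof --supports stmt-HodgeConjecture-24833 --as helper` (count-neutral).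

* §1 **`borelQuotientEquiv`-free index dictionary** `exists_equiv_borelQuot` : `Quotient (orbitRel ↥(borelU c J_N) ↥U(J_N)(F)) ≃ Γ ⧸ B_Γ` (`Γ = quotientSubgroup`, `B_Γ = borelAdelic ⊓ Γ`),
  `[γ] ↦ ι(γ)⁻¹ B_Γ` (Mathlib `QuotientGroup.quotientRightRelEquivQuotientLeftRel` + ★ p857274 §1 transport), stated as `∃ κ` with its values;
* §2 **`eisensteinSeriesU_eq_tsum_borelQuotient`**: for left-`B(F)`-invariant `f`, `eisensteinSeriesU f g = Σ'_{p ∈ Γ⧸B_Γ} f(p̃⁻¹ g)` — i.e. `= E_φ(g⁻¹)` for `φ = f ∘ inv` in the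
  currency of ★ p857309 (`eisensteinSeriesU_eq_rightSum`);
* §3 **`borelConstantTerm_eisensteinSeriesU_two ∕ _three`**: on `U(J₂)`, `U(J₃)`, for a Borel `f` left-invariant under `N(𝔸_F)` and `B(F)`, a left- and inversion-invariant `ν`, a
  fundamental domain `𝓕` of `N(F)` with `0 < ν(𝓕) < ∞`, and the finiteness binder of ★ p857309 at `(f ∘ inv, g⁻¹)`:
  `borelConstantTerm ν 𝓕 (eisensteinSeriesU f) g = f g + (ν 𝓕).toReal⁻¹ • ∫_{N(𝔸)} f(ι(J_N) · v · g) dν(v)` — the textbook `E_B(f) = f + M(w₀)f` [MW1995 II.1.7].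

HONEST LABEL.  Count-neutral helper; proves no printed statement; HC_CM is proved only modulo the 7 printed citations (2 remaining named inputs: hLiu418 =
`stmt-HodgeConjecture-24832`, h413 = `stmt-HodgeConjecture-24833`) until rung 0 closes.

## References
* [MoeglinWaldspurger1995] C. Mœglin, J.-L. Waldspurger, *Spectral decomposition and Eisenstein series* (1995), II.1.5, II.1.7.
* [Garrett2018] P. Garrett, *Modern Analysis of Automorphic Forms by Example* 1 (2018), §2.8, §3.10.
-/

set_option autoImplicit false
set_option linter.dupNamespace false  -- the mandated namespace repeats the summit's segment (`HodgeConjecture.HodgeConjecture`)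

noncomputable section
open MeasureTheory Measure Set Filter Topology NumberField IsDedekindDomain Matrix MulAction
open Literature.NumberTheory.Automorphic Literature.NumberTheory.Automorphic.UnitaryGroup AdelicGroupData
open Summit.HodgeConjecture.HodgeConjecture.Cruxes.H413.K2E1PseudoEisensteinConstantTermU
open Summit.HodgeConjecture.HodgeConjecture.Cruxes.H413.K2E1EisensteinIntertwiningU
open Summit.HodgeConjecture.HodgeConjecture.Cruxes.H413.K2E1BorelEisensteinU
open scoped ENNReal NNReal Pointwise MatrixGroups

namespace Summit.HodgeConjecture.HodgeConjecture.Cruxes.H413.K2E1EisensteinSeriesLeftRight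

variable {F E : Type} [Field F] [NumberField F] [Field E] [NumberField E] [Algebra F E] {c : E ≃ₐ[F] E} {N : ℕ}

/-! ## §1 The index dictionary `B(F)\U(J_N)(F) ≃ Γ ⧸ B_Γ`, `[γ] ↦ ι(γ)⁻¹ B_Γ` -/

section Index

/-- A left-`B_Γ`-INVARIANT function in the adelic currency from the rational hypothesis of ★ `eisensteinSeriesU`: `f(β y) = f(y)` for `β ∈ B_Γ = borelAdelic ⊓ Γ`
(`β = ι(b)`, `b ∈ borelU`, ★ p857274 §1). [folklore] -/
theorem apply_mul_of_mem_borelQuotient {f : (quasiSplit F E c N).Adelic → ℂ}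
    (hf : ∀ b ∈ borelU (c : E →+* E) ((StdForm.antidiagonal N).over E), ∀ x : (quasiSplit F E c N).Adelic, f ((quasiSplit F E c N).toAdelic b * x) = f x)
    {β : (quasiSplit F E c N).quotientSubgroup} (hβ : β ∈ (borelAdelic F E c N).subgroupOf (quasiSplit F E c N).quotientSubgroup) (y : (quasiSplit F E c N).Adelic) :
    f ((β : (quasiSplit F E c N).Adelic) * y) = f y := by
  obtain ⟨b, hb⟩ := exists_toAdelic_eq_of_mem_quotientSubgroup β
  rw [Subgroup.mem_subgroupOf, ← hb, K2E1PseudoEisensteinConstantTermU.toAdelic_mem_borelAdelic_iff] at hβ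
  rw [← hb]; exact hf b hβ y

/-- **THE INDEX DICTIONARY**: an equivalence `κ` from p08's index `B(F)\U(J_N)(F) = Quotient (orbitRel ↥borelU ↥U)` (= Mathlib `rightRel`) to the right-convention index
`Γ ⧸ B_Γ` of ★ p857309 with `κ [γ] = ι(γ)⁻¹ B_Γ` — `Bγ ↦ γ⁻¹B` (Mathlib `quotientRightRelEquivQuotientLeftRel`) followed by `ι : U(J_N)(F) ≃ Γ` (★ `toAdelic_injective_quasiSplit`,
★ `exists_toAdelic_eq_of_mem_quotientSubgroup`; `B(F) ↔ B_Γ` by ★ `toAdelic_mem_borelAdelic_iff`). [folklore] -/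
theorem exists_equiv_borelQuot :
    ∃ κ : Quotient (orbitRel ↥(borelU (c : E →+* E) ((StdForm.antidiagonal N).over E)) ↥(unitaryGroupOfForm (c : E →+* E) ((StdForm.antidiagonal N).over E))) ≃
        (quasiSplit F E c N).quotientSubgroup ⧸ (borelAdelic F E c N).subgroupOf (quasiSplit F E c N).quotientSubgroup,
      ∀ γ : ↥(unitaryGroupOfForm (c : E →+* E) ((StdForm.antidiagonal N).over E)),
        κ (Quotient.mk _ γ) = ((⟨(quasiSplit F E c N).toAdelic γ, toAdelic_mem_quotientSubgroup γ⟩⁻¹ : (quasiSplit F E c N).quotientSubgroup) :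
          (quasiSplit F E c N).quotientSubgroup ⧸ (borelAdelic F E c N).subgroupOf (quasiSplit F E c N).quotientSubgroup) := by
  -- `ι` as an equivalence `U(J_N)(F) ≃ Γ`
  let e : ↥(unitaryGroupOfForm (c : E →+* E) ((StdForm.antidiagonal N).over E)) ≃ (quasiSplit F E c N).quotientSubgroup :=
    Equiv.ofBijective (fun γ => ⟨(quasiSplit F E c N).toAdelic γ, toAdelic_mem_quotientSubgroup γ⟩)
      ⟨fun a b h => toAdelic_injective_quasiSplit (congrArg Subtype.val h), fun γ => by
        obtain ⟨g, hg⟩ := exists_toAdelic_eq_of_mem_quotientSubgroup γ; exact ⟨g, Subtype.ext hg⟩⟩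
  have he : ∀ γ, (e γ : (quasiSplit F E c N).Adelic) = (quasiSplit F E c N).toAdelic γ := fun _ => rfl
  -- transport of the left relation
  let κ₂ : ↥(unitaryGroupOfForm (c : E →+* E) ((StdForm.antidiagonal N).over E)) ⧸ borelU (c : E →+* E) ((StdForm.antidiagonal N).over E) ≃
      (quasiSplit F E c N).quotientSubgroup ⧸ (borelAdelic F E c N).subgroupOf (quasiSplit F E c N).quotientSubgroup :=
    Quotient.congr e fun a b => by
      rw [QuotientGroup.leftRel_apply, QuotientGroup.leftRel_apply, Subgroup.mem_subgroupOf, Subgroup.coe_mul, Subgroup.coe_inv, he, he,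
        ← map_inv, ← toAdelic_mul_quasiSplit, K2E1PseudoEisensteinConstantTermU.toAdelic_mem_borelAdelic_iff]
      exact Iff.rfl
  refine ⟨(QuotientGroup.quotientRightRelEquivQuotientLeftRel _).trans κ₂, fun γ => ?_⟩
  rfl

end Index

/-! ## §2 `eisensteinSeriesU f = E_{f ∘ inv} ∘ inv` -/

section Bridge

/-- **THE LEFT EISENSTEIN SERIES IS THE RIGHT-CONVENTION SUM**: for `f` left-`B(F)`-invariant, `eisensteinSeriesU f g = Σ'_{p ∈ Γ ⧸ B_Γ} f(p̃⁻¹ g)` (`p̃ = (p.out : Γ)`), by the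
index dictionary `[γ] ↦ ι(γ)⁻¹B_Γ` (Mathlib `Equiv.tsum_eq`) and the independence of the representatives (`f(β⁻¹ ι(γ) g) = f(ι(γ) g)`, `β ∈ B_Γ`). [cite: MoeglinWaldspurger1995, II.1.5] -/
theorem eisensteinSeriesU_eq_tsum_borelQuotient {f : (quasiSplit F E c N).Adelic → ℂ}
    (hf : ∀ b ∈ borelU (c : E →+* E) ((StdForm.antidiagonal N).over E), ∀ x : (quasiSplit F E c N).Adelic, f ((quasiSplit F E c N).toAdelic b * x) = f x)
    (g : (quasiSplit F E c N).Adelic) :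
    eisensteinSeriesU f g = ∑' p : (quasiSplit F E c N).quotientSubgroup ⧸ (borelAdelic F E c N).subgroupOf (quasiSplit F E c N).quotientSubgroup,
      f ((((p.out : (quasiSplit F E c N).quotientSubgroup) : (quasiSplit F E c N).Adelic))⁻¹ * g) := by
  obtain ⟨κ, hκ⟩ := exists_equiv_borelQuot (F := F) (E := E) (c := c) (N := N)
  rw [eisensteinSeriesU_def, ← κ.tsum_eq]
  refine tsum_congr fun q => ?_
  induction q using Quotient.inductionOn with
  | h γ =>
    rw [eisensteinSeriesU_term_eq hf γ g, hκ γ]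
    -- the representative of `ι(γ)⁻¹ B_Γ` is `ι(γ)⁻¹ β`, `β ∈ B_Γ`
    obtain ⟨β, hβ⟩ := QuotientGroup.mk_out_eq_mul ((borelAdelic F E c N).subgroupOf (quasiSplit F E c N).quotientSubgroup)
      ((⟨(quasiSplit F E c N).toAdelic γ, toAdelic_mem_quotientSubgroup γ⟩⁻¹ : (quasiSplit F E c N).quotientSubgroup))
    rw [hβ, Subgroup.coe_mul, Subgroup.coe_inv, _root_.mul_inv_rev, inv_inv, mul_assoc]
    have key := apply_mul_of_mem_borelQuotient hf (Subgroup.inv_mem _ β.2) ((quasiSplit F E c N).toAdelic γ * g)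
    rw [Subgroup.coe_inv] at key
    exact key.symm

/-- The same in the literal currency of ★ p857309 ∕ p857354: `eisensteinSeriesU f g = Σ'_{p} φ(g⁻¹ · p̃)` with `φ = fun y => f y⁻¹` — so every right-convention theorem of this seat
applies to `eisensteinSeriesU` at `(φ, x) = (f ∘ inv, g⁻¹)`. [cite: MoeglinWaldspurger1995, II.1.5] -/
theorem eisensteinSeriesU_eq_rightSum {f : (quasiSplit F E c N).Adelic → ℂ}
    (hf : ∀ b ∈ borelU (c : E →+* E) ((StdForm.antidiagonal N).over E), ∀ x : (quasiSplit F E c N).Adelic, f ((quasiSplit F E c N).toAdelic b * x) = f x)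
    (g : (quasiSplit F E c N).Adelic) :
    eisensteinSeriesU f g = ∑' p : (quasiSplit F E c N).quotientSubgroup ⧸ (borelAdelic F E c N).subgroupOf (quasiSplit F E c N).quotientSubgroup,
      (fun y : (quasiSplit F E c N).Adelic => f y⁻¹) (g⁻¹ * ((p.out : (quasiSplit F E c N).quotientSubgroup) : (quasiSplit F E c N).Adelic)) := by
  rw [eisensteinSeriesU_eq_tsum_borelQuotient hf g]
  refine tsum_congr fun p => ?_
  simp only [_root_.mul_inv_rev, inv_inv]

end Bridge

/-! ## §3 «`E_B(f)(g) = f(g) + ν(𝓕)⁻¹ ∫_{N(𝔸)} f(w₀ v g) dv`» for ★ `borelConstantTerm` on `U(J₂)`, `U(J₃)` -/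

section ConstantTerm

/-- **THE CONSTANT TERM OF THE LEFT EISENSTEIN SERIES ON `U(J₂)`** in the cell's ★ `borelConstantTerm` currency: for a Borel `f` left-invariant under `N(𝔸_F)` and `B(F)`, a left- and
inversion-invariant measure `ν` on `N(𝔸_F)`, a fundamental domain `𝓕` of `N(F)` with `ν(𝓕) ∉ {0, ∞}`, and `∫⁻_{u∈𝓕} Σ_{p∈Γ⧸B_Γ} ‖f(p̃⁻¹ u g)‖ dν < ∞` (Godement's majorant),
`borelConstantTerm ν 𝓕 (eisensteinSeriesU f) g = f g + (ν 𝓕).toReal⁻¹ • ∫_{N(𝔸_F)} f(ι(J₂) v g) dν(v)` — ★ p857354 `setIntegral_tsum_borelQuotient_eq_intertwiningU_quasiSplit_two` at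
`(φ, x) = (f ∘ inv, g⁻¹)` through §2, the inversion invariance of `ν` turning `M(w₀)(f∘inv)(g⁻¹) = ∫ f(w₀ v⁻¹ g)` into `∫ f(w₀ v g)`. [cite: MoeglinWaldspurger1995, II.1.7] -/
theorem borelConstantTerm_eisensteinSeriesU_two [MeasurableSpace (quasiSplit F E c 2).Adelic] [BorelSpace (quasiSplit F E c 2).Adelic]
    (νN : Measure ↥(adelicUnipotent F E c 2)) [νN.IsMulLeftInvariant] [νN.IsInvInvariant]
    {f : (quasiSplit F E c 2).Adelic → ℂ} (hfm : Measurable f)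
    (hfN : ∀ (n : ↥(adelicUnipotent F E c 2)) (y : (quasiSplit F E c 2).Adelic), f ((n : (quasiSplit F E c 2).Adelic) * y) = f y)
    (hfB : ∀ b ∈ borelU (c : E →+* E) ((StdForm.antidiagonal 2).over E), ∀ x : (quasiSplit F E c 2).Adelic, f ((quasiSplit F E c 2).toAdelic b * x) = f x)
    {𝓕 : Set ↥(adelicUnipotent F E c 2)} (h𝓕 : IsFundamentalDomain ↥(rationalUnipotent F E c 2) 𝓕 νN) (h𝓕₀ : νN 𝓕 ≠ 0) (h𝓕top : νN 𝓕 ≠ ∞)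
    (g : (quasiSplit F E c 2).Adelic)
    (hfin : ∫⁻ u in 𝓕, (∑' q : (quasiSplit F E c 2).quotientSubgroup ⧸ (borelAdelic F E c 2).subgroupOf (quasiSplit F E c 2).quotientSubgroup,
        ‖f ((((q.out : (quasiSplit F E c 2).quotientSubgroup) : (quasiSplit F E c 2).Adelic))⁻¹ * (u : (quasiSplit F E c 2).Adelic) * g)‖ₑ) ∂νN < ∞) :
    borelConstantTerm νN 𝓕 (eisensteinSeriesU f) g =
      f g + ((νN 𝓕).toReal⁻¹ : ℝ) • ∫ v : ↥(adelicUnipotent F E c 2),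
        f ((quasiSplit F E c 2).toAdelic (weylLongU (c : E →+* E) (rfl : (StdForm.antidiagonal 2).over E = (StdForm.antidiagonal 2).over E)) *
          (v : (quasiSplit F E c 2).Adelic) * g) ∂νN := by
  set φ : (quasiSplit F E c 2).Adelic → ℂ := fun y => f y⁻¹ with hφ
  have hφm : Measurable φ := hfm.comp measurable_inv
  have hφN : ∀ (y : (quasiSplit F E c 2).Adelic) (n : ↥(adelicUnipotent F E c 2)), φ (y * n) = φ y := fun y n => by
    simp only [hφ, _root_.mul_inv_rev, ← Subgroup.coe_inv]; exact hfN n⁻¹ y⁻¹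
  have hφB : ∀ (y : (quasiSplit F E c 2).Adelic) (b : (quasiSplit F E c 2).quotientSubgroup),
      b ∈ (borelAdelic F E c 2).subgroupOf (quasiSplit F E c 2).quotientSubgroup → φ (y * (b : (quasiSplit F E c 2).Adelic)) = φ y := fun y b hb => by
    simp only [hφ, _root_.mul_inv_rev]
    have key := apply_mul_of_mem_borelQuotient hfB (Subgroup.inv_mem _ hb) y⁻¹
    rwa [Subgroup.coe_inv] at key
  have hfin' : ∫⁻ u in 𝓕, (∑' q : (quasiSplit F E c 2).quotientSubgroup ⧸ (borelAdelic F E c 2).subgroupOf (quasiSplit F E c 2).quotientSubgroup,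
      ‖φ (g⁻¹ * (u : (quasiSplit F E c 2).Adelic)⁻¹ * ((q.out : (quasiSplit F E c 2).quotientSubgroup) : (quasiSplit F E c 2).Adelic))‖ₑ) ∂νN < ∞ := by
    simpa only [hφ, _root_.mul_inv_rev, inv_inv, mul_assoc] using hfin
  have key := setIntegral_tsum_borelQuotient_eq_intertwiningU_quasiSplit_two νN hφm hφN hφB h𝓕 g⁻¹ hfin'
  have hI : ∫ u in 𝓕, eisensteinSeriesU f ((u : (quasiSplit F E c 2).Adelic) * g) ∂νN =
      (νN 𝓕).toReal • φ g⁻¹ + intertwiningU (adelicUnipotent F E c 2) νN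
        ((quasiSplit F E c 2).toAdelic (weylLongU (c : E →+* E) (rfl : (StdForm.antidiagonal 2).over E = (StdForm.antidiagonal 2).over E))) φ g⁻¹ := by
    rw [← key]
    refine integral_congr_ae (Eventually.of_forall fun u => ?_)
    beta_reduce
    rw [eisensteinSeriesU_eq_tsum_borelQuotient hfB]
    refine tsum_congr fun p => ?_
    simp only [hφ, _root_.mul_inv_rev, inv_inv, mul_assoc]
  have hM : intertwiningU (adelicUnipotent F E c 2) νN
        ((quasiSplit F E c 2).toAdelic (weylLongU (c : E →+* E) (rfl : (StdForm.antidiagonal 2).over E = (StdForm.antidiagonal 2).over E))) φ g⁻¹ =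
      ∫ v : ↥(adelicUnipotent F E c 2), f ((quasiSplit F E c 2).toAdelic (weylLongU (c : E →+* E) (rfl : (StdForm.antidiagonal 2).over E = (StdForm.antidiagonal 2).over E)) *
        (v : (quasiSplit F E c 2).Adelic) * g) ∂νN := by
    rw [intertwiningU_apply, ← integral_inv_eq_self (fun v : ↥(adelicUnipotent F E c 2) =>
      f ((quasiSplit F E c 2).toAdelic (weylLongU (c : E →+* E) (rfl : (StdForm.antidiagonal 2).over E = (StdForm.antidiagonal 2).over E)) * (v : (quasiSplit F E c 2).Adelic) * g)) νN]
    refine integral_congr_ae (Eventually.of_forall fun v => ?_)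
    simp only [hφ, _root_.mul_inv_rev, inv_inv, Subgroup.coe_inv, mul_assoc]
  have hr : (νN 𝓕).toReal ≠ 0 := ENNReal.toReal_ne_zero.2 ⟨h𝓕₀, h𝓕top⟩
  have hφg : φ g⁻¹ = f g := by simp only [hφ, inv_inv]
  rw [borelConstantTerm_def, hI, hM, hφg, smul_add, smul_smul, inv_mul_cancel₀ hr, one_smul]

/-- **THE CONSTANT TERM OF THE LEFT EISENSTEIN SERIES ON `U(J₃)`** (the quasi-split `U(2,1)`, Heisenberg radical): verbatim §3 `_two` with ★ p857354
`setIntegral_tsum_borelQuotient_eq_intertwiningU_quasiSplit_three`: `borelConstantTerm ν 𝓕 (eisensteinSeriesU f) g = f g + (ν 𝓕).toReal⁻¹ • ∫_{N(𝔸_F)} f(ι(J₃) v g) dν(v)`.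
[cite: MoeglinWaldspurger1995, II.1.7] [cite: Rogawski1990, §2.2] -/
theorem borelConstantTerm_eisensteinSeriesU_three [MeasurableSpace (quasiSplit F E c 3).Adelic] [BorelSpace (quasiSplit F E c 3).Adelic]
    (νN : Measure ↥(adelicUnipotent F E c 3)) [νN.IsMulLeftInvariant] [νN.IsInvInvariant]
    {f : (quasiSplit F E c 3).Adelic → ℂ} (hfm : Measurable f)
    (hfN : ∀ (n : ↥(adelicUnipotent F E c 3)) (y : (quasiSplit F E c 3).Adelic), f ((n : (quasiSplit F E c 3).Adelic) * y) = f y)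
    (hfB : ∀ b ∈ borelU (c : E →+* E) ((StdForm.antidiagonal 3).over E), ∀ x : (quasiSplit F E c 3).Adelic, f ((quasiSplit F E c 3).toAdelic b * x) = f x)
    {𝓕 : Set ↥(adelicUnipotent F E c 3)} (h𝓕 : IsFundamentalDomain ↥(rationalUnipotent F E c 3) 𝓕 νN) (h𝓕₀ : νN 𝓕 ≠ 0) (h𝓕top : νN 𝓕 ≠ ∞)
    (g : (quasiSplit F E c 3).Adelic)
    (hfin : ∫⁻ u in 𝓕, (∑' q : (quasiSplit F E c 3).quotientSubgroup ⧸ (borelAdelic F E c 3).subgroupOf (quasiSplit F E c 3).quotientSubgroup,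
        ‖f ((((q.out : (quasiSplit F E c 3).quotientSubgroup) : (quasiSplit F E c 3).Adelic))⁻¹ * (u : (quasiSplit F E c 3).Adelic) * g)‖ₑ) ∂νN < ∞) :
    borelConstantTerm νN 𝓕 (eisensteinSeriesU f) g =
      f g + ((νN 𝓕).toReal⁻¹ : ℝ) • ∫ v : ↥(adelicUnipotent F E c 3),
        f ((quasiSplit F E c 3).toAdelic (weylLongU (c : E →+* E) (rfl : (StdForm.antidiagonal 3).over E = (StdForm.antidiagonal 3).over E)) *
          (v : (quasiSplit F E c 3).Adelic) * g) ∂νN := by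
  set φ : (quasiSplit F E c 3).Adelic → ℂ := fun y => f y⁻¹ with hφ
  have hφm : Measurable φ := hfm.comp measurable_inv
  have hφN : ∀ (y : (quasiSplit F E c 3).Adelic) (n : ↥(adelicUnipotent F E c 3)), φ (y * n) = φ y := fun y n => by
    simp only [hφ, _root_.mul_inv_rev, ← Subgroup.coe_inv]; exact hfN n⁻¹ y⁻¹
  have hφB : ∀ (y : (quasiSplit F E c 3).Adelic) (b : (quasiSplit F E c 3).quotientSubgroup),
      b ∈ (borelAdelic F E c 3).subgroupOf (quasiSplit F E c 3).quotientSubgroup → φ (y * (b : (quasiSplit F E c 3).Adelic)) = φ y := fun y b hb => by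
    simp only [hφ, _root_.mul_inv_rev]
    have key := apply_mul_of_mem_borelQuotient hfB (Subgroup.inv_mem _ hb) y⁻¹
    rwa [Subgroup.coe_inv] at key
  have hfin' : ∫⁻ u in 𝓕, (∑' q : (quasiSplit F E c 3).quotientSubgroup ⧸ (borelAdelic F E c 3).subgroupOf (quasiSplit F E c 3).quotientSubgroup,
      ‖φ (g⁻¹ * (u : (quasiSplit F E c 3).Adelic)⁻¹ * ((q.out : (quasiSplit F E c 3).quotientSubgroup) : (quasiSplit F E c 3).Adelic))‖ₑ) ∂νN < ∞ := by
    simpa only [hφ, _root_.mul_inv_rev, inv_inv, mul_assoc] using hfin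
  have key := setIntegral_tsum_borelQuotient_eq_intertwiningU_quasiSplit_three νN hφm hφN hφB h𝓕 g⁻¹ hfin'
  have hI : ∫ u in 𝓕, eisensteinSeriesU f ((u : (quasiSplit F E c 3).Adelic) * g) ∂νN =
      (νN 𝓕).toReal • φ g⁻¹ + intertwiningU (adelicUnipotent F E c 3) νN
        ((quasiSplit F E c 3).toAdelic (weylLongU (c : E →+* E) (rfl : (StdForm.antidiagonal 3).over E = (StdForm.antidiagonal 3).over E))) φ g⁻¹ := by
    rw [← key]
    refine integral_congr_ae (Eventually.of_forall fun u => ?_)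
    beta_reduce
    rw [eisensteinSeriesU_eq_tsum_borelQuotient hfB]
    refine tsum_congr fun p => ?_
    simp only [hφ, _root_.mul_inv_rev, inv_inv, mul_assoc]
  have hM : intertwiningU (adelicUnipotent F E c 3) νN
        ((quasiSplit F E c 3).toAdelic (weylLongU (c : E →+* E) (rfl : (StdForm.antidiagonal 3).over E = (StdForm.antidiagonal 3).over E))) φ g⁻¹ =
      ∫ v : ↥(adelicUnipotent F E c 3), f ((quasiSplit F E c 3).toAdelic (weylLongU (c : E →+* E) (rfl : (StdForm.antidiagonal 3).over E = (StdForm.antidiagonal 3).over E)) *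
        (v : (quasiSplit F E c 3).Adelic) * g) ∂νN := by
    rw [intertwiningU_apply, ← integral_inv_eq_self (fun v : ↥(adelicUnipotent F E c 3) =>
      f ((quasiSplit F E c 3).toAdelic (weylLongU (c : E →+* E) (rfl : (StdForm.antidiagonal 3).over E = (StdForm.antidiagonal 3).over E)) * (v : (quasiSplit F E c 3).Adelic) * g)) νN]
    refine integral_congr_ae (Eventually.of_forall fun v => ?_)
    simp only [hφ, _root_.mul_inv_rev, inv_inv, Subgroup.coe_inv, mul_assoc]
  have hr : (νN 𝓕).toReal ≠ 0 := ENNReal.toReal_ne_zero.2 ⟨h𝓕₀, h𝓕top⟩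
  have hφg : φ g⁻¹ = f g := by simp only [hφ, inv_inv]
  rw [borelConstantTerm_def, hI, hM, hφg, smul_add, smul_smul, inv_mul_cancel₀ hr, one_smul]

end ConstantTerm

end Summit.HodgeConjecture.HodgeConjecture.Cruxes.H413.K2E1EisensteinSeriesLeftRight

end
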